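import Mathlib
import Summits.QuantumAdvantage.QuantumAdvantage.Theses.MobiusLadder
import Summits.QuantumAdvantage.QuantumAdvantage.Theorems.MobiusLadderQuadraticDigitPhasesStubPeel
import Summits.QuantumAdvantage.QuantumAdvantage.Theorems.MobiusLadderQuadraticDigitPhasesStubCompact
import Summits.QuantumAdvantage.QuantumAdvantage.Theorems.MobiusLadderQuadraticDigitPhasesStubBszFixedN
import Summits.QuantumAdvantage.QuantumAdvantage.Theorems.MobiusLadderQuadraticDigitPhasesStubHi
import Summits.QuantumAdvantage.QuantumAdvantage.Theorems.MobiusLadderQuadraticDigitPhasesStubBlockCesaro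
import Summits.QuantumAdvantage.QuantumAdvantage.Theorems.MobiusLadderQuadraticDigitPhasesStubMomoKatai
import Summits.QuantumAdvantage.QuantumAdvantage.Theorems.MobiusLadderQuadraticDigitPhasesStubMomoAP
import Summits.QuantumAdvantage.QuantumAdvantage.Theorems.MobiusLadderQuadraticDigitPhasesStubMomoOfBranches
import Summits.QuantumAdvantage.QuantumAdvantage.Theorems.MobiusLadderQuadraticDigitPhasesStubSparseImageCount
import Summits.QuantumAdvantage.QuantumAdvantage.Theorems.MobiusLadderQuadraticDigitPhasesStubOneCutKatai
import Summits.QuantumAdvantage.QuantumAdvantage.Theorems.MobiusLadderQuadraticDigitPhasesStubDwdOfWords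
import Literature.NumberTheory.LFunctions.MatomakiRadziwillTaoTheorem13Proofs

/-!
# Crux `QuadraticDigitPhases` (stmt-QuantumAdvantage-1391) — the reduction to two λ-free carry-automaton statements

Line `Sketch` of the crux chain (lead prover-line-stmt-QuantumAdvantage-1391-0), assembled from its eleven landed
stubs.  PROVED here (no placeholders; conditional only on the two explicit hypotheses):

`quadraticDigitPhases_of_conjectures : WordDecay → LowCutKatai → QuadraticDigitPhases`

where both hypotheses are λ-FREE and QUADRATIC-FORM-FREE statements about the `pq`-state pair-carry chain of the
digit map `T ↦ (pT, qT)` for distinct odd primes `p, q`: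

* `WordDecay` (hypothesis `hWords`): every word over the four transfer letters `M_ab` of the `pq`-state pair-carry
  chain with at least `w(p,q,δ)` twisted letters sends the initial state `e₀₀` to a vector of `ℓ¹`-norm `≤ δ`
  (through the landed `stub_dwdOfWords` p115885 this gives the Walsh–dilation decay on intervals);
* `LowCutKatai` (hypothesis `hLow`): quadratic phases all of whose digit cuts have rank `< R₀` (bounded-width
  `𝔽₂`-linear automata) but which are not `(R,s)`-low still have Kátai pair sums `≤ τ M`.

Route: HIGH phases (not `(R,s)`-low) → far Kátai decay (`farKatai_of`: one cut of high rank, `stub_oneCutKatai`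
p113112 + `stub_sparseImageCount` p111916, or `hLow`) → Bourgain–Sarnak–Ziegler at fixed `N` (`stub_bszFixedN`
p102788, `stub_hi` p103373); LOW phases → peel the `< R` products (`stub_peel` p102772) → banded → compactness onto one
infinite banded phase (`stub_compact` p105219) → Konieczny's dichotomy for that `2`-semimultiplicative sequence
(`stub_momoOfBranches` p106685): almost periodic ⇒ MRT 2015 Thm 1.3 in dyadic blocks (`stub_momoAP` p109492), Kátai ⇒
uniform short-block control (`stub_blockCesaro` p106475) + BSZ on block concatenations (`stub_momoKatai` p106980).
-/

noncomputable section

set_option linter.dupNamespace false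

namespace Summit.QuantumAdvantage.QuantumAdvantage.Theorems.MobiusLadderQuadraticDigitPhasesReduction

open Finset Filter
open Summit.QuantumAdvantage.QuantumAdvantage.Theses.MobiusLadder

/-- Far Kátai decay from the two carry-automaton hypotheses: every quadratic `P` that is NOT `(R,s)`-low has Kátai
pair sums `≤ τ M` for distinct odd primes `p, q ≤ B`, `M ∈ [2^n/(2B), 2^n]` — by cases on the maximal cut rank
(one cut of rank `≥ R*` via `stub_oneCutKatai`, fed by `stub_dwdOfWords ∘ hWords` and `stub_sparseImageCount`; otherwise
`hLow`). -/
theorem farKatai_of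
    (hWords : ∀ p q : ℕ, ∀ hp : p.Prime, ∀ hq : q.Prime, p ≠ q → 2 < p → 2 < q →
      (∀ δ : ℝ, 0 < δ → ∃ w : ℕ, ∀ word : List (Bool × Bool),
        w ≤ (word.filter (fun ab => ab ≠ (false, false))).length →
        ∑ y : Fin p × Fin q,
          |((word.map (fun ab : Bool × Bool =>
            (Matrix.of fun (x y : Fin p × Fin q) =>
              ∑ t ∈ ({0, 1} : Finset ℕ),
                if (y.1 : ℕ) = (p * t + x.1) / 2 ∧ (y.2 : ℕ) = (q * t + x.2) / 2 then
                  (1 / 2 : ℝ) * (if ab.1 then (-1 : ℝ) ^ ((p * t + x.1) % 2) else 1) *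
                    (if ab.2 then (-1 : ℝ) ^ ((q * t + x.2) % 2) else 1)
                else 0))).prod)
            (⟨0, hp.pos⟩, ⟨0, hq.pos⟩) y| ≤ δ))
    (hLow : ∀ B : ℕ, ∀ τ : ℝ, 0 < τ → ∀ R₀ : ℕ, ∃ R s : ℕ, ∀ n : ℕ, ∀ P : MvPolynomial (Fin n) (ZMod 2),
      P.totalDegree ≤ 2 →
      (∀ c : ℕ, (Matrix.of fun (i j : Fin n) =>
            if (i : ℕ) < c ∧ c ≤ (j : ℕ) then
              MvPolynomial.coeff (Finsupp.single i 1 + Finsupp.single j 1) P else 0).rank < R₀) →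
      ¬ (∃ Q : MvPolynomial (Fin n) (ZMod 2), Q.totalDegree ≤ 2 ∧
          (∀ m ∈ Q.support, ∀ i ∈ m.support, ∀ j ∈ m.support, Nat.dist i j ≤ s) ∧
          ∃ k : ℕ, k < R ∧ ∃ u v : Fin k → Fin n → ZMod 2, ∀ x : Fin n → ZMod 2,
            MvPolynomial.eval x P = MvPolynomial.eval x Q +
              ∑ t : Fin k, (∑ i : Fin n, u t i * x i) * (∑ i : Fin n, v t i * x i)) →
      ∀ p q : ℕ, p.Prime → q.Prime → p ≠ q → 2 < p → 2 < q → p ≤ B → q ≤ B →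
      ∀ M : ℕ, M ≤ 2 ^ n → 2 ^ n ≤ 2 * B * M →
        |∑ m ∈ Icc 1 M,
          (if MvPolynomial.eval (fun i : Fin n => if Nat.testBit (p * m) i then (1 : ZMod 2) else 0) P = 1
            then (-1 : ℝ) else 1) *
          (if MvPolynomial.eval (fun i : Fin n => if Nat.testBit (q * m) i then (1 : ZMod 2) else 0) P = 1
            then (-1 : ℝ) else 1)| ≤ τ * M) :
    ∀ B : ℕ, ∀ τ : ℝ, 0 < τ → ∃ R s : ℕ, ∀ n : ℕ, ∀ P : MvPolynomial (Fin n) (ZMod 2),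
      P.totalDegree ≤ 2 →
      ¬ (∃ Q : MvPolynomial (Fin n) (ZMod 2), Q.totalDegree ≤ 2 ∧
          (∀ m ∈ Q.support, ∀ i ∈ m.support, ∀ j ∈ m.support, Nat.dist i j ≤ s) ∧
          ∃ k : ℕ, k < R ∧ ∃ u v : Fin k → Fin n → ZMod 2, ∀ x : Fin n → ZMod 2,
            MvPolynomial.eval x P = MvPolynomial.eval x Q +
              ∑ t : Fin k, (∑ i : Fin n, u t i * x i) * (∑ i : Fin n, v t i * x i)) →
      ∀ p q : ℕ, p.Prime → q.Prime → p ≠ q → 2 < p → 2 < q → p ≤ B → q ≤ B →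
      ∀ M : ℕ, M ≤ 2 ^ n → 2 ^ n ≤ 2 * B * M →
        |∑ m ∈ Icc 1 M,
          (if MvPolynomial.eval (fun i : Fin n => if Nat.testBit (p * m) i then (1 : ZMod 2) else 0) P = 1
            then (-1 : ℝ) else 1) *
          (if MvPolynomial.eval (fun i : Fin n => if Nat.testBit (q * m) i then (1 : ZMod 2) else 0) P = 1
            then (-1 : ℝ) else 1)| ≤ τ * M := by
  intro B τ hτ
  classical
  -- one threshold R₀ serving every pair of distinct odd primes ≤ B
  have hpair : ∀ pq : ℕ × ℕ, ∃ R₀ : ℕ, pq.1.Prime → pq.2.Prime → pq.1 ≠ pq.2 → 2 < pq.1 → 2 < pq.2 →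
      pq.1 ≤ B → pq.2 ≤ B → ∀ n : ℕ, ∀ P : MvPolynomial (Fin n) (ZMod 2), P.totalDegree ≤ 2 →
        ∀ c : ℕ, R₀ ≤ (Matrix.of fun (i j : Fin n) =>
            if (i : ℕ) < c ∧ c ≤ (j : ℕ) then
              MvPolynomial.coeff (Finsupp.single i 1 + Finsupp.single j 1) P else 0).rank →
        ∀ M : ℕ, M ≤ 2 ^ n → 2 ^ n ≤ 2 * B * M →
        |∑ m ∈ Icc 1 M,
          (if MvPolynomial.eval (fun i : Fin n => if Nat.testBit (pq.1 * m) i then (1 : ZMod 2) else 0) P = 1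
            then (-1 : ℝ) else 1) *
          (if MvPolynomial.eval (fun i : Fin n => if Nat.testBit (pq.2 * m) i then (1 : ZMod 2) else 0) P = 1
            then (-1 : ℝ) else 1)| ≤ τ * M := by
    rintro ⟨p, q⟩
    by_cases h : p.Prime ∧ q.Prime ∧ p ≠ q ∧ 2 < p ∧ 2 < q ∧ p ≤ B ∧ q ≤ B
    · obtain ⟨hp, hq, hne, hp2, hq2, hpB, hqB⟩ := h
      obtain ⟨R₀, hR₀⟩ := Summit.QuantumAdvantage.QuantumAdvantage.Theorems.MobiusLadderQuadraticDigitPhasesStubOneCutKatai.stub_oneCutKatai p q B hp hq hne hp2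
        hq2 hpB hqB (Summit.QuantumAdvantage.QuantumAdvantage.Theorems.MobiusLadderQuadraticDigitPhasesStubDwdOfWords.stub_dwdOfWords p q hp hq hne hp2 hq2
          (hWords p q hp hq hne hp2 hq2))
        Summit.QuantumAdvantage.QuantumAdvantage.Theorems.MobiusLadderQuadraticDigitPhasesStubSparseImageCount.stub_sparseImageCount τ hτ
      exact ⟨R₀, fun _ _ _ _ _ _ _ => hR₀⟩
    · exact ⟨0, fun hp hq hne hp2 hq2 hpB hqB => absurd ⟨hp, hq, hne, hp2, hq2, hpB, hqB⟩ h⟩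
  choose R₀f hR₀f using hpair
  set Rstar : ℕ := (Finset.range (B + 1) ×ˢ Finset.range (B + 1)).sup R₀f with hRstar
  obtain ⟨R, s, hlow⟩ := hLow B τ hτ Rstar
  refine ⟨R, s, fun n P hP hnot p q hp hq hne hp2 hq2 hpB hqB M hM hBM => ?_⟩
  by_cases hcut : ∃ c : ℕ, Rstar ≤ (Matrix.of fun (i j : Fin n) =>
      if (i : ℕ) < c ∧ c ≤ (j : ℕ) then
        MvPolynomial.coeff (Finsupp.single i 1 + Finsupp.single j 1) P else 0).rank
  · obtain ⟨c, hc⟩ := hcut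
    have hmem : (p, q) ∈ Finset.range (B + 1) ×ˢ Finset.range (B + 1) := by
      simp only [Finset.mem_product, Finset.mem_range]; omega
    have hle : R₀f (p, q) ≤ Rstar := hRstar ▸ Finset.le_sup hmem
    exact hR₀f (p, q) hp hq hne hp2 hq2 hpB hqB n P hP c (hle.trans hc) M hM hBM
  · push Not at hcut
    exact hlow n P hP hcut hnot p q hp hq hne hp2 hq2 hpB hqB M hM hBM

/-- The per-sequence input of the banded branch, assembled from the landed stubs and the tree's (proved)
Matomäki–Radziwiłł–Tao 2015 Theorem 1.3: for every infinite `s`-banded quadratic form the dyadic block statistic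
of its phase against `λ` is `o(2^n)` (`k → ∞` first). -/
theorem banded_blocks (s : ℕ) :
    ∀ (quad : ℕ → ℕ → ZMod 2) (lin : ℕ → ZMod 2),
      (∀ i j, quad i j ≠ 0 → i < j ∧ j ≤ i + s) →
      ∀ ε : ℝ, 0 < ε → ∀ᶠ k : ℕ in atTop, ∀ᶠ n : ℕ in atTop,
        ∑ b ∈ range (2 ^ (n - k)),
          |∑ a ∈ range (2 ^ k), ((ArithmeticFunction.liouville (2 ^ k * b + a) : ℤ) : ℝ) *
            (if (∑ i ∈ range (2 ^ k * b + a + 1), ∑ j ∈ range (2 ^ k * b + a + 1),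
                    quad i j * (if Nat.testBit (2 ^ k * b + a) i then (1 : ZMod 2) else 0) *
                      (if Nat.testBit (2 ^ k * b + a) j then (1 : ZMod 2) else 0)) +
                  ∑ i ∈ range (2 ^ k * b + a + 1),
                    lin i * (if Nat.testBit (2 ^ k * b + a) i then (1 : ZMod 2) else 0) = 1
              then (-1 : ℝ) else 1)| ≤ ε * (2 : ℝ) ^ n :=
  Summit.QuantumAdvantage.QuantumAdvantage.Theorems.MobiusLadderQuadraticDigitPhasesStubMomoOfBranches.stub_momoOfBranches
    (Summit.QuantumAdvantage.QuantumAdvantage.Theorems.MobiusLadderQuadraticDigitPhasesStubMomoAP.stub_momoAP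
      Literature.NumberTheory.LFunctions.Tao2016.MatomakiRadziwillTao2015_theorem13_holds)
    Summit.QuantumAdvantage.QuantumAdvantage.Theorems.MobiusLadderQuadraticDigitPhasesStubBlockCesaro.stub_blockCesaro
    (Summit.QuantumAdvantage.QuantumAdvantage.Theorems.MobiusLadderQuadraticDigitPhasesStubMomoKatai.stub_momoKatai
      Summit.QuantumAdvantage.QuantumAdvantage.Theorems.MobiusLadderQuadraticDigitPhasesStubBszFixedN.stub_bszFixedN) s

/-- **The crux modulo the two carry-automaton statements.**  `QuadraticDigitPhases` (digital quadratic
uniformity of the Liouville function, uniformly over all quadratic `𝔽₂`-phases of the `n` binary digits) follows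
from `WordDecay` (`hWords`) and `LowCutKatai` (`hLow`): HIGH phases by `farKatai_of` + Bourgain–Sarnak–Ziegler
at fixed `N` (`stub_hi`, `stub_bszFixedN`), `(R,s)`-LOW phases by peeling (`stub_peel`), compactness
(`stub_compact`) and `banded_blocks`. -/
theorem quadraticDigitPhases_of_conjectures :
    (∀ p q : ℕ, ∀ hp : p.Prime, ∀ hq : q.Prime, p ≠ q → 2 < p → 2 < q →
      (∀ δ : ℝ, 0 < δ → ∃ w : ℕ, ∀ word : List (Bool × Bool),
        w ≤ (word.filter (fun ab => ab ≠ (false, false))).length →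
        ∑ y : Fin p × Fin q,
          |((word.map (fun ab : Bool × Bool =>
            (Matrix.of fun (x y : Fin p × Fin q) =>
              ∑ t ∈ ({0, 1} : Finset ℕ),
                if (y.1 : ℕ) = (p * t + x.1) / 2 ∧ (y.2 : ℕ) = (q * t + x.2) / 2 then
                  (1 / 2 : ℝ) * (if ab.1 then (-1 : ℝ) ^ ((p * t + x.1) % 2) else 1) *
                    (if ab.2 then (-1 : ℝ) ^ ((q * t + x.2) % 2) else 1)
                else 0))).prod)
            (⟨0, hp.pos⟩, ⟨0, hq.pos⟩) y| ≤ δ)) →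
    (∀ B : ℕ, ∀ τ : ℝ, 0 < τ → ∀ R₀ : ℕ, ∃ R s : ℕ, ∀ n : ℕ, ∀ P : MvPolynomial (Fin n) (ZMod 2),
      P.totalDegree ≤ 2 →
      (∀ c : ℕ, (Matrix.of fun (i j : Fin n) =>
            if (i : ℕ) < c ∧ c ≤ (j : ℕ) then
              MvPolynomial.coeff (Finsupp.single i 1 + Finsupp.single j 1) P else 0).rank < R₀) →
      ¬ (∃ Q : MvPolynomial (Fin n) (ZMod 2), Q.totalDegree ≤ 2 ∧
          (∀ m ∈ Q.support, ∀ i ∈ m.support, ∀ j ∈ m.support, Nat.dist i j ≤ s) ∧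
          ∃ k : ℕ, k < R ∧ ∃ u v : Fin k → Fin n → ZMod 2, ∀ x : Fin n → ZMod 2,
            MvPolynomial.eval x P = MvPolynomial.eval x Q +
              ∑ t : Fin k, (∑ i : Fin n, u t i * x i) * (∑ i : Fin n, v t i * x i)) →
      ∀ p q : ℕ, p.Prime → q.Prime → p ≠ q → 2 < p → 2 < q → p ≤ B → q ≤ B →
      ∀ M : ℕ, M ≤ 2 ^ n → 2 ^ n ≤ 2 * B * M →
        |∑ m ∈ Icc 1 M,
          (if MvPolynomial.eval (fun i : Fin n => if Nat.testBit (p * m) i then (1 : ZMod 2) else 0) P = 1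
            then (-1 : ℝ) else 1) *
          (if MvPolynomial.eval (fun i : Fin n => if Nat.testBit (q * m) i then (1 : ZMod 2) else 0) P = 1
            then (-1 : ℝ) else 1)| ≤ τ * M) →
    Summit.QuantumAdvantage.QuantumAdvantage.Theses.MobiusLadder.QuadraticDigitPhases := by
  intro hWords hLow ε hε
  obtain ⟨R, s, hHi⟩ := Summit.QuantumAdvantage.QuantumAdvantage.Theorems.MobiusLadderQuadraticDigitPhasesStubHi.stub_hi
    Summit.QuantumAdvantage.QuantumAdvantage.Theorems.MobiusLadderQuadraticDigitPhasesStubBszFixedN.stub_bszFixedN (farKatai_of hWords hLow) ε hε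
  have hLo := Summit.QuantumAdvantage.QuantumAdvantage.Theorems.MobiusLadderQuadraticDigitPhasesStubPeel.stub_peel s R
    (Summit.QuantumAdvantage.QuantumAdvantage.Theorems.MobiusLadderQuadraticDigitPhasesStubCompact.stub_compact s (banded_blocks s)) ε hε
  filter_upwards [hHi, hLo] with n hnHi hnLo P hP
  by_cases hlow : ∃ Q : MvPolynomial (Fin n) (ZMod 2), Q.totalDegree ≤ 2 ∧
      (∀ m ∈ Q.support, ∀ i ∈ m.support, ∀ j ∈ m.support, Nat.dist i j ≤ s) ∧
      ∃ k : ℕ, k < R ∧ ∃ u v : Fin k → Fin n → ZMod 2, ∀ x : Fin n → ZMod 2,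
        MvPolynomial.eval x P = MvPolynomial.eval x Q +
          ∑ t : Fin k, (∑ i : Fin n, u t i * x i) * (∑ i : Fin n, v t i * x i)
  · exact hnLo P hP hlow
  · exact hnHi P hP hlow

end Summit.QuantumAdvantage.QuantumAdvantage.Theorems.MobiusLadderQuadraticDigitPhasesReduction

end
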